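import Mathlib.LinearAlgebra.Matrix.SpecialLinearGroup
import Mathlib.LinearAlgebra.Matrix.Charpoly.Coeff
import Mathlib.Algebra.Field.ZMod
import Mathlib.GroupTheory.Abelianization.Defs
import Mathlib.Tactic.NormNum.Prime
import Mathlib.Tactic.LinearCombination
import HarnessLib

/-!
# `SL₂(𝔽₇)`: element orders from traces, reality of order-`8` elements, perfectness

RepresentationTheory/FiniteGroups file: fully PROVED theorems about the finite group
`SL₂(𝔽₇)` (no definitions, no named facts), the group-theoretic input of the proof of
`psl27_degreeThree_charpoly_mod_seven` (`PSL27DegreeThreeModSevenProofs.lean`): the conjugacy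
classes of `SL₂(𝔽₇)` are separated by the trace up to the two unipotent classes of each sign
(Bonnafé, *Representations of `SL₂(𝔽_q)`*, Table 11.4 and §1.3: representatives `±I₂`,
`d(j)`, `d(-j)`, `d'(i)`, `d'(ζ₈)`, `d'(ζ₈³)`, `±u_±` of orders `1, 2, 3, 6, 4, 8, 8, 7, 14`), and
what the proof downstream needs about each class is exactly an identity `gⁿ = ±1` determined by
`t = tr g ∈ 𝔽₇`:

* `sl2_mul_self` — Cayley–Hamilton `g² = t g - 1` in `SL₂(R)`; `sl2_trace_mul_self`;
* `sl27_sq_of_trace_zero` (`t = 0 ⇒ g² = -1`), `sl27_pow_three_of_trace_one` (`g³ = -1`),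
  `sl27_pow_three_of_trace_six` (`g³ = 1`), `sl27_pow_four_of_trace_three`,
  `sl27_pow_four_of_trace_four` (`g⁴ = -1`), `sl27_pow_seven_of_trace_two` (`g⁷ = 1`),
  `sl27_pow_seven_of_trace_five` (`g⁷ = -1`) — each from a polynomial identity
  `Xⁿ ∓ 1 = (X² - tX + 1) q + 7 r` in `ℤ[X]` (closed by `ring`) pushed through `aeval g`;
* `sl27_exists_conj_eq_inv` — **elements with `t² = 2` (order `8`) are conjugate to their
  inverses in `SL₂(𝔽₇)`** (the classes `d'(ζ₈)`, `d'(ζ₈³)` are real; the conjugator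
  `(x y; z -x)` is found by a `decide` search, `sl27_conj_aux`);
* `sl27_trace_of_commutator_T` — if `g T g⁻¹ T⁻¹ = ±1` for `T = (1 1; 0 1)` then `tr g = ±2`;
* `sl27_map_eq_one_of_comm` — `SL₂(𝔽₇)` is perfect (Bonnafé Thm 1.2.4 (a); Mathlib's
  `Matrix.SL2.commutator_eq_top`), so it has no non-trivial abelian quotient.

## References

* [Bonnafe2011] C. Bonnafé, *Representations of `SL₂(𝔽_q)`*, Algebra and Applications 13,
  Springer (2011), Thm 1.2.4, §1.3, Table 11.4.
-/

noncomputable section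

open Polynomial

open scoped MatrixGroups

namespace Literature.RepresentationTheory.FiniteGroups

namespace PSL27

section SL2Facts

/-! ### `SL₂(𝔽₇)`: Cayley–Hamilton, orders from traces, a conjugacy, a commutator -/

/-- Cayley–Hamilton for `SL₂`: `g² = tr(g) g - 1`. [folklore] -/
theorem sl2_mul_self {R : Type*} [CommRing R] (g : SL(2, R)) :
    (g : Matrix (Fin 2) (Fin 2) R) * g =
      (g : Matrix (Fin 2) (Fin 2) R).trace • (g : Matrix (Fin 2) (Fin 2) R) - 1 := by
  obtain ⟨A, hA⟩ := g
  rw [Matrix.det_fin_two] at hA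
  ext i j
  fin_cases i <;> fin_cases j <;>
    simp [Matrix.mul_apply, Fin.sum_univ_two, Matrix.trace_fin_two] <;>
    first | ring1 | linear_combination -hA

/-- `tr(g²) = tr(g)² - 2` in `SL₂`. [folklore] -/
theorem sl2_trace_mul_self {R : Type*} [CommRing R] (g : SL(2, R)) :
    ((g * g : SL(2, R)) : Matrix (Fin 2) (Fin 2) R).trace =
      (g : Matrix (Fin 2) (Fin 2) R).trace ^ 2 - 2 := by
  rw [Matrix.SpecialLinearGroup.coe_mul, sl2_mul_self, Matrix.trace_sub, Matrix.trace_smul,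
    Matrix.trace_one, Fintype.card_fin, smul_eq_mul, sq]
  norm_num

/-- Cayley–Hamilton in `aeval` form for `SL₂(𝔽₇)`: `g² - t g + 1 = 0`, `t = tr g`. [folklore] -/
theorem sl27_aeval_charpoly (g : SL(2, ZMod 7)) (t : ZMod 7)
    (ht : (g : Matrix (Fin 2) (Fin 2) (ZMod 7)).trace = t) :
    aeval (g : Matrix (Fin 2) (Fin 2) (ZMod 7)) (X ^ 2 - C t * X + 1 : (ZMod 7)[X]) = 0 := by
  haveI : Fact (Nat.Prime 7) := ⟨by norm_num⟩
  have h := Matrix.aeval_self_charpoly (g : Matrix (Fin 2) (Fin 2) (ZMod 7))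
  rwa [Matrix.charpoly_fin_two, Matrix.SpecialLinearGroup.det_coe, map_one, ht] at h

/-- `7 = 0` in `𝔽₇[X]`. [folklore] -/
theorem seven_eq_zero_polyF7 : (7 : (ZMod 7)[X]) = 0 := by
  simpa using CharP.cast_eq_zero (ZMod 7)[X] 7

/-- Transfer of a polynomial identity modulo `7` and modulo the characteristic polynomial:
if `p = (X² - tX + 1) q + 7 r` then `p(g) = 0`. [folklore] -/
theorem sl27_aeval_eq_zero (g : SL(2, ZMod 7)) (t : ZMod 7)
    (ht : (g : Matrix (Fin 2) (Fin 2) (ZMod 7)).trace = t) (p q r : (ZMod 7)[X])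
    (hid : p = (X ^ 2 - C t * X + 1) * q + 7 * r) :
    aeval (g : Matrix (Fin 2) (Fin 2) (ZMod 7)) p = 0 := by
  rw [hid, map_add, map_mul, sl27_aeval_charpoly g t ht, zero_mul, zero_add, map_mul,
    seven_eq_zero_polyF7, map_zero, zero_mul]

/-- From `gⁿ - 1 = 0` (as a matrix polynomial identity) to `gⁿ = 1` in `SL₂(𝔽₇)`. [folklore] -/
theorem sl27_pow_eq_one_of_aeval (g : SL(2, ZMod 7)) (n : ℕ)
    (h : aeval (g : Matrix (Fin 2) (Fin 2) (ZMod 7)) (X ^ n - 1 : (ZMod 7)[X]) = 0) :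
    g ^ n = 1 := by
  simp only [map_sub, map_pow, aeval_X, map_one, sub_eq_zero] at h
  apply Subtype.ext
  rw [Matrix.SpecialLinearGroup.coe_pow, h, Matrix.SpecialLinearGroup.coe_one]

/-- From `gⁿ + 1 = 0` (as a matrix polynomial identity) to `gⁿ = -1` in `SL₂(𝔽₇)`. [folklore] -/
theorem sl27_pow_eq_neg_one_of_aeval (g : SL(2, ZMod 7)) (n : ℕ)
    (h : aeval (g : Matrix (Fin 2) (Fin 2) (ZMod 7)) (X ^ n + 1 : (ZMod 7)[X]) = 0) :
    g ^ n = -1 := by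
  simp only [map_add, map_pow, aeval_X, map_one] at h
  apply Subtype.ext
  rw [Matrix.SpecialLinearGroup.coe_pow, eq_neg_of_add_eq_zero_left h,
    Matrix.SpecialLinearGroup.coe_neg, Matrix.SpecialLinearGroup.coe_one]

/-- Trace `0` ⇒ `g² = -1` (order `4`). [folklore] -/
theorem sl27_sq_of_trace_zero (g : SL(2, ZMod 7))
    (ht : (g : Matrix (Fin 2) (Fin 2) (ZMod 7)).trace = 0) : g ^ 2 = -1 :=
  sl27_pow_eq_neg_one_of_aeval g 2 (sl27_aeval_eq_zero g 0 ht _ 1 0 (by simp))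

/-- Trace `1` ⇒ `g³ = -1` (order `6`): `X³ + 1 = (X² - X + 1)(X + 1)`. [folklore] -/
theorem sl27_pow_three_of_trace_one (g : SL(2, ZMod 7))
    (ht : (g : Matrix (Fin 2) (Fin 2) (ZMod 7)).trace = 1) : g ^ 3 = -1 :=
  sl27_pow_eq_neg_one_of_aeval g 3 (sl27_aeval_eq_zero g 1 ht _ (X + 1) 0 (by simp; ring1))

/-- Trace `-1` ⇒ `g³ = 1` (order `3`): `X³ - 1 ≡ (X² - 6X + 1)(X - 1) (mod 7)`. [folklore] -/
theorem sl27_pow_three_of_trace_six (g : SL(2, ZMod 7))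
    (ht : (g : Matrix (Fin 2) (Fin 2) (ZMod 7)).trace = 6) : g ^ 3 = 1 :=
  sl27_pow_eq_one_of_aeval g 3 (sl27_aeval_eq_zero g 6 ht _ (X - 1) (X ^ 2 - X)
    (by simp only [map_ofNat]; ring1))

/-- Trace `3` ⇒ `g⁴ = -1` (order `8`): `X⁴ + 1 ≡ (X² - 3X + 1)(X² + 3X + 1) (mod 7)`. [folklore] -/
theorem sl27_pow_four_of_trace_three (g : SL(2, ZMod 7))
    (ht : (g : Matrix (Fin 2) (Fin 2) (ZMod 7)).trace = 3) : g ^ 4 = -1 :=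
  sl27_pow_eq_neg_one_of_aeval g 4 (sl27_aeval_eq_zero g 3 ht _ (X ^ 2 + 3 * X + 1) (X ^ 2)
    (by simp only [map_ofNat]; ring1))

/-- Trace `4` ⇒ `g⁴ = -1` (order `8`): `X⁴ + 1 ≡ (X² - 4X + 1)(X² + 4X + 1) (mod 7)`. [folklore] -/
theorem sl27_pow_four_of_trace_four (g : SL(2, ZMod 7))
    (ht : (g : Matrix (Fin 2) (Fin 2) (ZMod 7)).trace = 4) : g ^ 4 = -1 :=
  sl27_pow_eq_neg_one_of_aeval g 4 (sl27_aeval_eq_zero g 4 ht _ (X ^ 2 + 4 * X + 1) (2 * X ^ 2)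
    (by simp only [map_ofNat]; ring1))

/-- Trace `2` ⇒ `g⁷ = 1` (order `1` or `7`): `X⁷ - 1 ≡ (X - 1)⁷ (mod 7)`. [folklore] -/
theorem sl27_pow_seven_of_trace_two (g : SL(2, ZMod 7))
    (ht : (g : Matrix (Fin 2) (Fin 2) (ZMod 7)).trace = 2) : g ^ 7 = 1 :=
  sl27_pow_eq_one_of_aeval g 7 (sl27_aeval_eq_zero g 2 ht _ ((X - 1) ^ 5)
    (-X + 3 * X ^ 2 - 5 * X ^ 3 + 5 * X ^ 4 - 3 * X ^ 5 + X ^ 6) (by simp only [map_ofNat]; ring1))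

/-- Trace `-2` ⇒ `g⁷ = -1` (order `2` or `14`): `X⁷ + 1 ≡ (X + 1)⁷ (mod 7)`. [folklore] -/
theorem sl27_pow_seven_of_trace_five (g : SL(2, ZMod 7))
    (ht : (g : Matrix (Fin 2) (Fin 2) (ZMod 7)).trace = 5) : g ^ 7 = -1 :=
  sl27_pow_eq_neg_one_of_aeval g 7 (sl27_aeval_eq_zero g 5 ht _ ((X + 1) ^ 5)
    (2 * X ^ 2 + 5 * X ^ 3 + 5 * X ^ 4 + 2 * X ^ 5) (by simp only [map_ofNat]; ring1))

/-- `tr(±I₂) = ±2`: an element of trace `∉ {2, -2}` is not `±1`. [folklore] -/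
theorem sl27_ne_one_and_ne_neg_one (g : SL(2, ZMod 7)) {t : ZMod 7}
    (ht : (g : Matrix (Fin 2) (Fin 2) (ZMod 7)).trace = t) (h2 : t ≠ 2) (h5 : t ≠ -2) :
    g ≠ 1 ∧ g ≠ -1 := by
  constructor
  · rintro rfl
    rw [Matrix.SpecialLinearGroup.coe_one, Matrix.trace_one, Fintype.card_fin] at ht
    exact h2 (by rw [← ht]; norm_num)
  · rintro rfl
    rw [Matrix.SpecialLinearGroup.coe_neg, Matrix.SpecialLinearGroup.coe_one, Matrix.trace_neg,
      Matrix.trace_one, Fintype.card_fin] at ht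
    exact h5 (by rw [← ht]; norm_num)

/-- The finite search behind `sl27_exists_conj_eq_inv`: for `t² = 2` and `a(t - a) - bc = 1` there
are `x, y, z ∈ 𝔽₇` with `x² + yz = -1` and `(2a - t)x + cy + bz = 0` (a non-degenerate plane
section of the split quadric; checked by `decide`). [folklore] -/
theorem sl27_conj_aux : ∀ t a b c : ZMod 7, t * t = 2 → a * (t - a) - b * c = 1 →
    ∃ x y z : ZMod 7, x * x + y * z = -1 ∧ (a - (t - a)) * x + c * y + b * z = 0 := by
  decide +kernel

/-- **Elements of order `8` of `SL₂(𝔽₇)` are real**: if `tr(g)² = 2` then `g` is conjugate to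
`g⁻¹` in `SL₂(𝔽₇)` (by an element `h = (x y; z -x)` of order `4`). [folklore] -/
theorem sl27_exists_conj_eq_inv (g : SL(2, ZMod 7))
    (ht : (g : Matrix (Fin 2) (Fin 2) (ZMod 7)).trace * (g : Matrix (Fin 2) (Fin 2) (ZMod 7)).trace
      = 2) : ∃ h : SL(2, ZMod 7), h * g * h⁻¹ = g⁻¹ := by
  obtain ⟨A, hA⟩ := g
  have hd : A 0 0 * A 1 1 - A 0 1 * A 1 0 = 1 := by rw [← Matrix.det_fin_two]; exact hA
  have htr : A.trace = A 0 0 + A 1 1 := Matrix.trace_fin_two A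
  obtain ⟨x, y, z, h1, h2⟩ := sl27_conj_aux A.trace (A 0 0) (A 0 1) (A 1 0) ht
    (by rw [htr]; linear_combination hd)
  rw [htr] at h2
  refine ⟨⟨!![x, y; z, -x], by rw [Matrix.det_fin_two_of]; linear_combination -h1⟩, ?_⟩
  rw [mul_inv_eq_iff_eq_mul]
  apply Subtype.ext
  simp only [Matrix.SpecialLinearGroup.coe_mul, Matrix.SpecialLinearGroup.coe_inv,
    Matrix.adjugate_fin_two]
  rw [Matrix.eta_fin_two A]
  simp only [Matrix.mul_fin_two, Matrix.of_apply, Matrix.cons_val', Matrix.cons_val_zero,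
    Matrix.cons_val_one, Matrix.empty_val', Matrix.cons_val_fin_one]
  ext i j
  fin_cases i <;> fin_cases j <;> simp <;> first | ring1 | linear_combination h2

/-- **Only `±I₂` commute with `T = (1 1; 0 1)` up to sign**: if `g T g⁻¹ T⁻¹ = ±1` then
`tr g = ±2`. [folklore] -/
theorem sl27_trace_of_commutator_T (g T : SL(2, ZMod 7))
    (hTc : (T : Matrix (Fin 2) (Fin 2) (ZMod 7)) = !![1, 1; 0, 1])
    (h : g * T * g⁻¹ * T⁻¹ = 1 ∨ g * T * g⁻¹ * T⁻¹ = -1) :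
    (g : Matrix (Fin 2) (Fin 2) (ZMod 7)).trace = 2 ∨
      (g : Matrix (Fin 2) (Fin 2) (ZMod 7)).trace = -2 := by
  obtain ⟨A, hA⟩ := g
  have hd : A 0 0 * A 1 1 - A 0 1 * A 1 0 = 1 := by rw [← Matrix.det_fin_two]; exact hA
  rw [Matrix.trace_fin_two]
  change A 0 0 + A 1 1 = 2 ∨ A 0 0 + A 1 1 = -2
  rcases h with h | h
  · -- `g T = T g`
    rw [mul_inv_eq_one, mul_inv_eq_iff_eq_mul] at h
    have hm := congrArg (fun k : SL(2, ZMod 7) => (k : Matrix (Fin 2) (Fin 2) (ZMod 7))) h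
    simp only [Matrix.SpecialLinearGroup.coe_mul, hTc] at hm
    rw [Matrix.eta_fin_two A, Matrix.mul_fin_two, Matrix.mul_fin_two] at hm
    have e00 := congrArg (fun m : Matrix (Fin 2) (Fin 2) (ZMod 7) => m 0 0) hm
    have e01 := congrArg (fun m : Matrix (Fin 2) (Fin 2) (ZMod 7) => m 0 1) hm
    simp at e00 e01
    -- `c = 0`, `a = d`, `a² = 1`
    have key : ∀ a c d : ZMod 7, c = 0 → a = d → a * d - 0 = 1 → a + d = 2 ∨ a + d = -2 := by
      decide
    have hc : A 1 0 = 0 := by linear_combination e00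
    refine key (A 0 0) (A 1 0) (A 1 1) hc (by linear_combination e01) ?_
    linear_combination hd + A 0 1 * hc
  · -- `g T = -T g`
    rw [mul_inv_eq_iff_eq_mul, mul_inv_eq_iff_eq_mul] at h
    have hm := congrArg (fun k : SL(2, ZMod 7) => (k : Matrix (Fin 2) (Fin 2) (ZMod 7))) h
    simp only [Matrix.SpecialLinearGroup.coe_mul, Matrix.SpecialLinearGroup.coe_neg, hTc,
      neg_mul, one_mul] at hm
    rw [Matrix.eta_fin_two A, Matrix.mul_fin_two, Matrix.mul_fin_two] at hm
    have e00 := congrArg (fun m : Matrix (Fin 2) (Fin 2) (ZMod 7) => m 0 0) hm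
    have e10 := congrArg (fun m : Matrix (Fin 2) (Fin 2) (ZMod 7) => m 1 0) hm
    simp at e00 e10
    have key : ∀ a c : ZMod 7, c = -c → a = -(a + c) → a = 0 ∧ c = 0 := by decide
    obtain ⟨ha, hc⟩ := key (A 0 0) (A 1 0) (by linear_combination e10) (by linear_combination e00)
    exfalso
    have : (0 : ZMod 7) = 1 := by
      rw [← hd, ha, hc]; ring
    exact absurd this (by decide)

/-- **`SL₂(𝔽₇)` is perfect**, so every homomorphism to an abelian group is trivial (Mathlib's
`Matrix.SL2.commutator_eq_top` with `a = 2`, `a² = 4 ≠ 1`). [cite: Bonnafe2011, Thm 1.2.4] -/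
theorem sl27_map_eq_one_of_comm {A : Type*} [CommGroup A] (f : SL(2, ZMod 7) →* A)
    (g : SL(2, ZMod 7)) : f g = 1 := by
  have h2 : (2 : ZMod 7) ≠ 0 := by decide
  have h4 : (2 : ZMod 7) ^ 2 ≠ 1 := by decide
  haveI : Fact (Nat.Prime 7) := ⟨by norm_num⟩
  have htop : commutator SL(2, ZMod 7) = ⊤ := Matrix.SL2.commutator_eq_top h2 h4
  have hg : g ∈ commutator SL(2, ZMod 7) := by rw [htop]; exact Subgroup.mem_top g
  exact Abelianization.commutator_subset_ker f hg

end SL2Facts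

end PSL27

end Literature.RepresentationTheory.FiniteGroups

end
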